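import Summits.BirchSwinnertonDyer.BirchSwinnertonDyer.Theorems.Rank1ResidualJetCarrierMultKitOrder
import HarnessLib

/-!
# T1 JET (cell `bsd-jet`), bucket B-mult (carrier `q = p = 3`, `E` SPLIT MULTIPLICATIVE at `3`):
# SAMPLE by-name records through the two kits — `384h1` (road O, no (ram) prime exists) and `201b1`
# (road Rm and road O)

HONEST FRAMING (programme file §HONESTY, verbatim): «no tranche here proves BSD; ARM L moves the
LITERAL column of an r ≤ 1 census into the kernel-proved-modulo-named-print column». THEOREMS ONLY
(seat `bsd-jet-pv-2`, session g2; `--supports stmt-BirchSwinnertonDyer-14418`, helper). PURPOSE: the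
worked TEMPLATE (for the row generator, seat `bsd-jet-ty`) of the two bucket-B-mult roads at `p = 3`
— road O `JET.bsdp_of_jetRowCarrierMult_of_irr_of_order` (`Rank1ResidualJetCarrierMultKitOrder.lean`:
image from an irreducible Frobenius and a Frobenius of order `3`) and road Rm
`JET.bsdp_of_jetRowCarrierMult_of_ram` (`Rank1ResidualJetCarrierMultKit.lean`: image from an
irreducible Frobenius and a (ram) prime `m ≠ 3`) — on two census rows of
`HOME/census-jet/jet_keys_B_classes.tsv` 4c8599cf93bc5459 (witnesses from the kit table
`HOME/sheets/pv2-B3-witness/witness_B_p3.tsv` ebbb16b79ae268fe, job j262920): `384h1` (p = 3, B,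
split `I₃` at `3`, `c₃ = 3`, `r = 1`, `D = −23`, `ord₃ I_K = 1`; the ONLY other bad prime is `2`,
additive — so NO (ram) witness exists and road O is the one by-name road) and `201b1` (p = 3, B,
split `I₃`, `c₃ = 3`, `r = 1`, `D = −8`, `ord₃ I_K = 1`; (ram) witness `67 ∥ Δ`). It is also the
ANTI-VACUITY check of the kits' numeric hypotheses on real data (every `decide`/`norm_num` goal
below closes). The Heegner datum (`K`, `N`, `P`), the index line `ord₃ [E(K):ℤP] ≤ ord₃ c₃` and
`#Ш_an` stay DISPLAYED binders (the cell's two-engine index certificates supply them per row;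
nothing about them is computed here), as do the READING binder `hJ : JET.JetchevDivisibilityCarrierMult`
(audit sheet `HOME/sheets/PV2-B-GAP.md`; referee C R385: GAPPED-in-print, gap closed BY NAME) and the
published `hMcU`, `hGZK`, `hKo`, `hrec`, `hD36`, `hlev`. CONDITIONAL; nothing is booked; 0 classes move.

Numeric data (Cremona `allcurves`, recomputed in the kernel below): `384h1 = [0,1,0,−35,69]`,
`Δ = 6912 = 2⁸·3³`, `c₄ = 1696 = 2⁵·53`, `c₆ = −69760`, `#Ẽ(𝔽₅) = 10` (`a₅ = −4`), `#Ẽ(𝔽₁₃) = 12`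
(`a₁₃ = 2`); `201b1 = [1,0,0,−1,2]`, `Δ = −1809 = −3³·67`, `c₄ = 49`, `c₆ = −1801`, `#Ẽ(𝔽₅) = 7`
(`a₅ = −1`), `#Ẽ(𝔽₃₁) = 39` (`a₃₁ = −7`).

References: [Jetchev2008] Cor. 1.5 (p. 812); [Cremona2006] Table 1; [Serre1972] §2.4 Prop. 15;
[Mazur1978] Prop. 6.3 (1); [Kraus1989] Prop. 1–2; [Wuthrich2014] Lemma 20.
-/

set_option autoImplicit false

noncomputable section

open scoped Classical

open WeierstrassCurve Literature.NumberTheory.EllipticCurves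
  Literature.NumberTheory.EllipticCurves.ModularForms
  Literature.NumberTheory.EllipticCurves.Rank1Residual
  Literature.NumberTheory.EllipticCurves.Rank1Residual.X11RankOneCertificates
  Summit.BirchSwinnertonDyer.BirchSwinnertonDyer.Rank1Residual
  Summit.BirchSwinnertonDyer.BirchSwinnertonDyer.Rank1Residual.IntModel
  Summit.BirchSwinnertonDyer.BirchSwinnertonDyer.Rank1Residual.X11RankOne
  Summit.BirchSwinnertonDyer.Rank1Residual Summit.BirchSwinnertonDyer.Rank1Residual.X11b

namespace Summit.BirchSwinnertonDyer.Rank1Residual.JET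

/-- **`BSD(E,3)` for `384h1` through the bucket-B-mult kit, road O** (`N = 384 = 2⁷·3`; model
`[0,1,0,−35,69]`, `Δ = 2⁸·3³`, `c₄ = 1696`; SPLIT MULTIPLICATIVE (`I₃`) at `3` with `c₃ = 3` — the
CARRIER is `3` itself; `r_an = 1`; the only other bad prime `2` is additive, so no (ram) witness
exists and road O is the by-name road). Kernel: `Δ ≠ 0`, support `[(2,7,8),(3,1,3)]` with the Kraus
test at each prime, `3 ∣ Δ`, `3 ∤ c₄`, Frobenius witnesses `(5, 10)` irreducible mod `3`
(`a₅ = −4`, `X² + X + 2` root-free) and `(13, 12)` of order `3` (`13 ≡ 1`, `a₁₃ = 2 (mod 3)`,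
`9 ∤ 12`); the `3`-adic tower by the Tate line inside the kit. Displayed binders: `hJ` (READING K3),
`hMcU`, `hGZK`, `hKo`, `hrec`, `hD36`, `hlev` (published), the Heegner datum and the index line AT
THE CARRIER `3`. CONDITIONAL; nothing booked. [cite: Jetchev2008, Cor. 1.5 (p. 812)]
[cite: Cremona2006, Table 1 (label 384h1)] [cite: Serre1972, §2.4 Prop. 15] -/
theorem bsdp_jetBmult_384h1_3_order
    (hJ : JetchevDivisibilityCarrierMult)
    (hMcU : McCallum1991_padicValNat_card_sha_primary_add_le_of_globalDivisibility)
    (hGZK : rank_eq_analyticRank_of_analyticRank_le_one)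
    (hKo : ∀ (N : ℕ) [NeZero N] (W : WeierstrassCurve ℚ) (K : Type) [Field K] [NumberField K],
      kolyvagin N W K)
    (hrec : ∀ (N : ℕ) [NeZero N] (W : WeierstrassCurve ℚ) (K : Type) [Field K] [NumberField K],
      heegnerPointOfConductor_one_galoisConj N W K)
    (hD36 : ∀ (N : ℕ) [NeZero N] (W : WeierstrassCurve ℚ) (K : Type) [Field K] [NumberField K],
      phi_heegnerTau_mem_singularModuliField N W K)
    (hlev : ∀ {N : ℕ} [NeZero N], IsNewformOf.level_eq_conductorNorm (N := N))
    (W : WeierstrassCurve ℚ) (hW : W = ⟨0, 1, 0, -35, 69⟩)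
    {N : ℕ} [NeZero N] {K : Type} [Field K] [NumberField K] (hK : IsImaginaryQuadratic K)
    (hD3 : NumberField.discr K ≠ -3) (hD4 : NumberField.discr K ≠ -4)
    (hH : SatisfiesHeegnerHypothesis N K) {P : (W.baseChange K).toAffine.Point}
    (hP : IsHeegnerPoint N W K P) (hnt : ¬ IsOfFinAddOrder P)
    (hI : padicValNat 3 (AddSubgroup.zmultiples P).index ≤
      padicValNat 3 ((W.baseChange ℚ_[3]).localTamagawaNumber ℤ_[3]))
    (hr : W.analyticRank ≤ 1) {s : ℚ} (hs : shaAn W = (s : ℂ)) (hv : padicValRat 3 s = 0) :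
    BSDp W 3 :=
  bsdp_of_jetRowCarrierMult_of_irr_of_order 3 Nat.prime_three (by norm_num) 0 1 0 (-35) 69
    (by decide +kernel) [(2, 7, 8), (3, 1, 3)]
    (by intro t ht; simp only [List.mem_cons, List.not_mem_nil, or_false] at ht
        rcases ht with rfl | rfl <;> norm_num)
    (by decide +kernel) (by decide +kernel) (by decide +kernel) (by decide +kernel)
    5 13 (by norm_num) (by norm_num) (by norm_num) (by norm_num) (by norm_num) (by norm_num)
    (by decide +kernel) (by decide +kernel) (n₁ := 10) (n₂ := 12) (by decide +kernel)
    (by decide +kernel) (by decide) (by decide) hJ hMcU hGZK hKo hrec hD36 hlev W hW hK hD3 hD4 hH hP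
    hnt hI hr hs hv

/-- **`BSD(E,3)` for `201b1` through the bucket-B-mult kit, road Rm** (`N = 201 = 3·67`; model
`[1,0,0,−1,2]`, `Δ = −3³·67`, `c₄ = 49`; SPLIT MULTIPLICATIVE (`I₃`) at `3` with `c₃ = 3` — the
carrier is `3`; `r_an = 1`). Kernel: `Δ ≠ 0`, support `[(3,1,3),(67,1,1)]` with the Kraus test at each
prime, `3 ∣ Δ`, `3 ∤ c₄`, Frobenius witness `(5, 7)` irreducible mod `3` (`a₅ = −1`, `X² + X + 2`
root-free), (ram) witness `m = 67` (`67 ∥ Δ`, `67 ∤ c₄`, `3 ∤ 1`); the tower by the Tate line inside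
the kit. Displayed binders as in `bsdp_jetBmult_384h1_3_order`. CONDITIONAL; nothing booked.
[cite: Jetchev2008, Cor. 1.5 (p. 812)] [cite: Cremona2006, Table 1 (label 201b1)]
[cite: Mazur1978, §6 Prop. 6.3 (1) (p. 153)] [cite: Wuthrich2014, Lemma 20 (p. 399)] -/
theorem bsdp_jetBmult_201b1_3_ram
    (hJ : JetchevDivisibilityCarrierMult)
    (hMcU : McCallum1991_padicValNat_card_sha_primary_add_le_of_globalDivisibility)
    (hGZK : rank_eq_analyticRank_of_analyticRank_le_one)
    (hKo : ∀ (N : ℕ) [NeZero N] (W : WeierstrassCurve ℚ) (K : Type) [Field K] [NumberField K],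
      kolyvagin N W K)
    (hrec : ∀ (N : ℕ) [NeZero N] (W : WeierstrassCurve ℚ) (K : Type) [Field K] [NumberField K],
      heegnerPointOfConductor_one_galoisConj N W K)
    (hD36 : ∀ (N : ℕ) [NeZero N] (W : WeierstrassCurve ℚ) (K : Type) [Field K] [NumberField K],
      phi_heegnerTau_mem_singularModuliField N W K)
    (hlev : ∀ {N : ℕ} [NeZero N], IsNewformOf.level_eq_conductorNorm (N := N))
    (W : WeierstrassCurve ℚ) (hW : W = ⟨1, 0, 0, -1, 2⟩)
    {N : ℕ} [NeZero N] {K : Type} [Field K] [NumberField K] (hK : IsImaginaryQuadratic K)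
    (hD3 : NumberField.discr K ≠ -3) (hD4 : NumberField.discr K ≠ -4)
    (hH : SatisfiesHeegnerHypothesis N K) {P : (W.baseChange K).toAffine.Point}
    (hP : IsHeegnerPoint N W K P) (hnt : ¬ IsOfFinAddOrder P)
    (hI : padicValNat 3 (AddSubgroup.zmultiples P).index ≤
      padicValNat 3 ((W.baseChange ℚ_[3]).localTamagawaNumber ℤ_[3]))
    (hr : W.analyticRank ≤ 1) {s : ℚ} (hs : shaAn W = (s : ℂ)) (hv : padicValRat 3 s = 0) :
    BSDp W 3 :=
  bsdp_of_jetRowCarrierMult_of_ram 3 Nat.prime_three (by norm_num) 1 0 0 (-1) 2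
    (by decide +kernel) [(3, 1, 3), (67, 1, 1)]
    (by intro t ht; simp only [List.mem_cons, List.not_mem_nil, or_false] at ht
        rcases ht with rfl | rfl <;> norm_num)
    (by decide +kernel) (by decide +kernel) (by decide +kernel) (by decide +kernel)
    5 (by norm_num) (by norm_num) (by norm_num) (by decide +kernel) (n := 7) (by decide +kernel)
    (by decide) 67 (by norm_num) (by norm_num) (by decide +kernel) (by decide +kernel) (e := 1)
    (by decide +kernel) (by decide +kernel) (by norm_num) hJ hMcU hGZK hKo hrec hD36 hlev W hW hK hD3
    hD4 hH hP hnt hI hr hs hv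

/-- **`BSD(E,3)` for `201b1` through the bucket-B-mult kit, road O** (same pair; image from the
Frobenius witnesses `(5, 7)` irreducible mod `3` and `(31, 39)` of order `3` (`31 ≡ 1`,
`a₃₁ = −7 ≡ 2 (mod 3)`, `9 ∤ 39`) — the (ram)-free road, shown to agree with road Rm on a row that
has both). Displayed binders as in `bsdp_jetBmult_384h1_3_order`. CONDITIONAL; nothing booked.
[cite: Jetchev2008, Cor. 1.5 (p. 812)] [cite: Cremona2006, Table 1 (label 201b1)]
[cite: Serre1972, §2.4 Prop. 15] -/
theorem bsdp_jetBmult_201b1_3_order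
    (hJ : JetchevDivisibilityCarrierMult)
    (hMcU : McCallum1991_padicValNat_card_sha_primary_add_le_of_globalDivisibility)
    (hGZK : rank_eq_analyticRank_of_analyticRank_le_one)
    (hKo : ∀ (N : ℕ) [NeZero N] (W : WeierstrassCurve ℚ) (K : Type) [Field K] [NumberField K],
      kolyvagin N W K)
    (hrec : ∀ (N : ℕ) [NeZero N] (W : WeierstrassCurve ℚ) (K : Type) [Field K] [NumberField K],
      heegnerPointOfConductor_one_galoisConj N W K)
    (hD36 : ∀ (N : ℕ) [NeZero N] (W : WeierstrassCurve ℚ) (K : Type) [Field K] [NumberField K],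
      phi_heegnerTau_mem_singularModuliField N W K)
    (hlev : ∀ {N : ℕ} [NeZero N], IsNewformOf.level_eq_conductorNorm (N := N))
    (W : WeierstrassCurve ℚ) (hW : W = ⟨1, 0, 0, -1, 2⟩)
    {N : ℕ} [NeZero N] {K : Type} [Field K] [NumberField K] (hK : IsImaginaryQuadratic K)
    (hD3 : NumberField.discr K ≠ -3) (hD4 : NumberField.discr K ≠ -4)
    (hH : SatisfiesHeegnerHypothesis N K) {P : (W.baseChange K).toAffine.Point}
    (hP : IsHeegnerPoint N W K P) (hnt : ¬ IsOfFinAddOrder P)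
    (hI : padicValNat 3 (AddSubgroup.zmultiples P).index ≤
      padicValNat 3 ((W.baseChange ℚ_[3]).localTamagawaNumber ℤ_[3]))
    (hr : W.analyticRank ≤ 1) {s : ℚ} (hs : shaAn W = (s : ℂ)) (hv : padicValRat 3 s = 0) :
    BSDp W 3 :=
  bsdp_of_jetRowCarrierMult_of_irr_of_order 3 Nat.prime_three (by norm_num) 1 0 0 (-1) 2
    (by decide +kernel) [(3, 1, 3), (67, 1, 1)]
    (by intro t ht; simp only [List.mem_cons, List.not_mem_nil, or_false] at ht
        rcases ht with rfl | rfl <;> norm_num)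
    (by decide +kernel) (by decide +kernel) (by decide +kernel) (by decide +kernel)
    5 31 (by norm_num) (by norm_num) (by norm_num) (by norm_num) (by norm_num) (by norm_num)
    (by decide +kernel) (by decide +kernel) (n₁ := 7) (n₂ := 39) (by decide +kernel)
    (by decide +kernel) (by decide) (by decide) hJ hMcU hGZK hKo hrec hD36 hlev W hW hK hD3 hD4 hH hP
    hnt hI hr hs hv

end Summit.BirchSwinnertonDyer.Rank1Residual.JET

end
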